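import Literature.AlgebraicGeometry.Villaflor2022.TwoLinearCyclesColonIdeals
import Literature.AlgebraicGeometry.Villaflor2022.TwoLinearCyclesThreshold
import HarnessLib

/-!
# The rank of Movasati's period matrix `[p_{i+j}(u·ℙ + v·ℙ̌)]` for two linear cycles of the Fermat variety
# (Villaflor 2022 Thm. 3 / Movasati–Villaflor 2018 Thm. 2 / Movasati 2016 Thm. 13 and Table 1), all `(n, d, m)`

H. Movasati, R. Villaflor Loyola, *Periods of linear algebraic cycles*, Pure Appl. Math. Q. 14 (2018)
= arXiv:1705.00084 [MovasatiVillaflor2018], §5–6 and **Theorem 2**: `ρ_i := ∫_ℙ ω_i + ∫_ℙ̌ ω_i`, the matrix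
`[ρ_{i+j}]` (rows `I_{(n/2)d−n−2}`, columns `I_d`), **Proposition 1** (its rank, "by a computer") and "Knowing that
`ker [ρ_{i+j}]` is the Zariski tangent space of the analytic scheme `V_{[Z_0]}` … Proposition 1 implies that
`V_{[Z_0]}` is smooth and reduced" for the triples `(n,d,m)` of Thm. 2 (`(2,d,−1)`, `5 ≤ d ≤ 14`; `(4,4,−1)`,
`(4,5,−1)`, `(4,6,−1)`, `(4,5,0)`, `(4,6,0)`; `(6,3,−1)`, `(6,4,−1)`, `(6,4,0)`; `(8,3,−1)`, `(8,3,0)`; `(10,3,−1)`,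
`(10,3,0)`, `(10,3,1)`).

R. Villaflor Loyola, manuscripta math. 167 (2022) = arXiv:1812.03964 [Villaflor2022PeriodsCI], **Theorem 3** and
**Remark 7**: "Theorem 3 is reduced to show that `T_0V_{[ℙ^{n/2}]} ∩ T_0V_{[ℙ̌^{n/2}]} = T_0V_{[δ]}` if and only if
`m < n/2 − d/(d−2)`" — "We generalize [MV] (providing a theoretic proof) to arbitrary degree and dimension"; §9:
"`Codim T_0V_{[ℙ^{n/2}]} ∩ T_0V_{[ℙ̌^{n/2}]} = 2·Codim T_0V_{[ℙ^{n/2}]} − Codim(T_0V_{[ℙ^{n/2}]} + T_0V_{[ℙ̌^{n/2}]})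
= 2(C(n/2+d,d) − (n/2+1)²) − (C(m+d,d) − (m+1)²)`" ("this computation can be found in [ho13]").

H. Movasati, arXiv:1602.06607 = Ch. 18 of *A Course in Hodge Theory* [Movasati2016Periods]: **Theorem 13**
(`intdim^d_n(m) = 2·C_{1^{n/2+1},(d−1)^{n/2+1}} − C_{1^{n−m+1},(d−1)^{m+1}}`, tree `Kloosterman2023.intdim`), §6
**Table 1** (`(mydim³ₙ(m), intdim³ₙ(m))` for cubic `n`-folds, `n = 4, …, 12`, tree `Movasati2016.cubicTable`) and the
nine five-tuples `(n,d,m | rank, intdim)` of §6 for `d = 4,5,6`.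

R. Kloosterman, arXiv:2312.12363 [Kloosterman2025], Prop. 4.1 / Ex. 4.2 (the Fermat pair: excess `1` for
`(c−1)(d−2) = 2` and `k+1−c` for `(c−1)(d−2) = 1`, `c = n/2 − m`).

## What this file PROVES (0 facts, 0 sorry), for EVERY even `n`, `d` with `n + 2 ≤ (n/2)d`, `ζ ≠ 0`, every
## permutation `b`, twist vectors `a, a'` giving DISTINCT cycles `ℙ_{a,b} ≠ ℙ_{a',b}`, and coefficients `u, v ≠ 0`

With `m + 1 :=` the number of common pairs of `ℙ_{a,b}, ℙ_{a',b}` (`ℙ_{a,b} ∩ ℙ_{a',b} = ℙ^m`; `commonPairs`) and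
`ciH_{m+1}(k) := ciHilbert [d−1,…,d−1] ((m+1) entries) k = #{β ∈ [0,d−2]^{m+1} : |β| = k}`:

* **`rank_periodMatrix_two_linearCycles`** (MAIN):
  `rank [p_{i+j}(u·ℙ_{a,b} + v·ℙ_{a',b})] = 2·(C(n/2+d,d) − (n/2+1)²) − ciH_{m+1}(d) − ciH_{m+1}((n/2)d − n − 2)`
  — the first two terms are Movasati's `intdim^d_n(m)` (`= codim (T_0V_ℙ ∩ T_0V_ℙ̌)`, Thm. 13 / Villaflor §9, here
  the THEOREM `hilbert_inf_two_linearCycles`: `dim S_d − dim (Ann ℓ_ℙ ∩ Ann ℓ_ℙ̌)_d = intdim`), the last one is the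
  exact excess of the companion file (`σ − d = (n/2)d − n − 2` is the ROW degree);
* `rank_periodMatrix_two_linearCycles_int`: the same as `= Kloosterman2023.intdim n d (m+1) − ciH_{m+1}((n/2)d−n−2)`;
* **`rank_eq_hilbert_inf_iff`**: `rank = intdim ⟺ 2 < (n/2 − m − 1)(d − 2)` (⟺ `m < n/2 − d/(d−2)`, Villaflor's
  threshold; Kloosterman's `(c−1)(d−2) > 2`) — Theorem 3 / Remark 7 at the level of the period matrix, and the
  "strictly bigger Zariski tangent space" half for `m ≥ n/2 − d/(d−2)`, for ALL `(n, d, m)`: MV18's Proposition 1 /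
  Theorem 2 list without the computer (`rank_eq_hilbert_inf_of_mem_mvTriples`);
* `movasatiTable_rank_eq`: the 25 printed RANKS of Movasati's cubic Table 1 with `c = n/2 − m ≥ 1` ARE the values of
  the formula (`decide`), i.e. every cell of the table is an instance of the theorem; `movasati_fiveTuples_rank_eq`:
  likewise the nine printed five-tuples of §6 (`d = 4, 5, 6`).
* named closed forms of the excess in Kloosterman's three small cases `(c, d) ∈ {(2,3), (3,3), (2,4)}` (Prop. 4.1's
  printed bounds "`k + 1 − c`" and "one", ATTAINED): `rank_two_linearCycles_cubic_codimTwo` (`rank = intdim − (n/2 − 1)`,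
  every cubic pair meeting in codimension 2, all even `n`), `excess_two_linearCycles_cubic_codimTwo`,
  `rank_two_linearCycles_cubic_codimThree` (`intdim − 1`), `rank_two_linearCycles_quartic_codimTwo` (`intdim − 1`; the
  census's `(6,4,1)`: `37 − 36`, `(8,4,2)`: `84 − 83`).
* **`excess_two_linearCycles_cubic_eq_excessLaw`**: Movasati's cubic excess law of Table 1 (`intdim − rank = C(n/2,2)`,
  `n/2 − 1`, `1`, `0` for `c = 1, 2, 3, ≥ 4`; tree `Movasati2016.excessLaw`, there checked on the 25 printed cells)
  holds for EVERY even `n`, every pair with a common pairing, both signs; `rank_two_linearCycles_quartic_codimOne`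
  (`d = 4`, planes meeting in codimension 1: `rank = intdim − C(n/2+1, 2)`; the census's R7 rows `(4,4,1)`: `11 − 3`).

NOT formalised (cited only): `ker [p_{i+j}] = T_0V_δ` (Movasati Thm. 6 / Villaflor Cor. 3), the scheme `V_δ`,
`codim (V_ℙ ∩ V_ℙ̌) = intdim` (Movasati Thm. 13's geometric side), smoothness/reducedness conclusions.

HONEST FRAMING (cell pub-hlocus): certified instances and evidence bearing on the general Hodge conjecture; no claim.
-/

noncomputable section

open MvPolynomial Module Literature.RingTheory.MvPolynomial Literature.AlgebraicGeometry.Kloosterman2025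
  Literature.AlgebraicGeometry.HodgeTheory Literature.AlgebraicGeometry.DuqueFrancoVillaflor2025
  Literature.AlgebraicGeometry.MovasatiVillaflor2018 Literature.AlgebraicGeometry.Movasati2016

open Literature.AlgebraicGeometry.Kloosterman2023 (ciHilbert linC intdim)

attribute [local instance] MvPolynomial.gradedAlgebra

namespace Literature.AlgebraicGeometry.Villaflor2022

variable {K : Type*} [Field K]

/-! ## Transport along a relabeling of the variables -/

section Transport

variable {σ σ' : Type*}

/-- For a bijection `θ` of variable sets, `I.map (rename θ) = I.comap (rename θ⁻¹)`. [folklore] -/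
private theorem map_rename_eq_comap_rename_symm (θ : σ ≃ σ') (I : Ideal (MvPolynomial σ K)) :
    I.map (rename θ : MvPolynomial σ K →ₐ[K] MvPolynomial σ' K) =
      I.comap (rename θ.symm : MvPolynomial σ' K →ₐ[K] MvPolynomial σ K) := by
  apply le_antisymm
  · refine Ideal.map_le_iff_le_comap.mpr fun g hg => ?_
    rw [Ideal.mem_comap, Ideal.mem_comap, rename_rename, Equiv.symm_comp_self, rename_id, AlgHom.id_apply]
    exact hg
  · intro q hq
    rw [Ideal.mem_comap] at hq
    have h : rename θ (rename θ.symm q) = q := by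
      rw [rename_rename, Equiv.self_comp_symm, rename_id, AlgHom.id_apply]
    rw [← h]
    exact Ideal.mem_map_of_mem _ hq

/-- **The Hilbert function of `Ann(ℓ ∘ relabeling)` is that of `Ann(ℓ)`** (Villaflor: "After relabeling the
variables"). [cite: Villaflorloyola2021, Proposition 4.1] [cite: Kloosterman2025, Lemma 2.1] -/
theorem hilbert_annIdeal_comp_rename_symm [Finite σ] [Finite σ'] (θ : σ ≃ σ') (ℓ : MvPolynomial σ K →ₗ[K] K)
    (k : ℕ) :
    finrank K (homogeneousSubmodule σ' K k) -
        finrank K (idealDegree (annIdeal (ℓ ∘ₗ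
          (rename θ.symm : MvPolynomial σ' K →ₐ[K] MvPolynomial σ K).toLinearMap)) k) =
      finrank K (homogeneousSubmodule σ K k) - finrank K (idealDegree (annIdeal ℓ) k) := by
  rw [annIdeal_comp_of_surjective _ (rename_surjective _ θ.symm.surjective),
    ← map_rename_eq_comap_rename_symm, hilbert_map_rename_equiv]

/-- … and for the intersection of two annihilators. [cite: Villaflorloyola2021, Proposition 4.1]
[cite: Kloosterman2025, Notation 2.4] -/
theorem hilbert_inf_annIdeal_comp_rename_symm [Finite σ] [Finite σ'] (θ : σ ≃ σ')
    (ℓ ℓ' : MvPolynomial σ K →ₗ[K] K) (k : ℕ) :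
    finrank K (homogeneousSubmodule σ' K k) -
        finrank K (idealDegree
          (annIdeal (ℓ ∘ₗ (rename θ.symm : MvPolynomial σ' K →ₐ[K] MvPolynomial σ K).toLinearMap) ⊓
            annIdeal (ℓ' ∘ₗ (rename θ.symm : MvPolynomial σ' K →ₐ[K] MvPolynomial σ K).toLinearMap)) k) =
      finrank K (homogeneousSubmodule σ K k) - finrank K (idealDegree (annIdeal ℓ ⊓ annIdeal ℓ') k) := by
  rw [annIdeal_comp_of_surjective _ (rename_surjective _ θ.symm.surjective),
    annIdeal_comp_of_surjective _ (rename_surjective _ θ.symm.surjective), ← Ideal.comap_inf,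
    ← map_rename_eq_comap_rename_symm, hilbert_map_rename_equiv]

end Transport

/-! ## The Hilbert functions of one linear cycle on the pairs `Fin p ⊕ Fin p` -/

section OneCycle

variable {p : ℕ}

/-- `h_{Ann ℓ_t}(k) = ciHilbert [e,…,e] (p entries) k` for the period functional of `P_t` on `p` pairs
("`HF_λ = HF_{[ℙ^{n/2}]}`", DFV Rem. 7.1). [cite: DuqueFrancoVillaflor2025Join, Remark 7.1]
[cite: Kloosterman2023, §2 eq. (1)] -/
theorem hilbert_annIdeal_fermatLinearCycleFunctional (t : Fin p → K) {e : ℕ} (he : 1 ≤ e) (k : ℕ) :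
    finrank K (homogeneousSubmodule (Fin p ⊕ Fin p) K k) -
        finrank K (idealDegree (annIdeal (fermatLinearCycleFunctional t e)) k) =
      ciHilbert (List.replicate p e) k := by
  classical
  rw [annIdeal_fermatLinearCycleFunctional t e he, hilbert_fermatLinearCycleIdeal_eq_card t e he k, ← List.ofFn_const]
  convert card_filter_finsuppAntidiag_eq_ciHilbert (fun _ : Fin p => e) (fun _ => he) k using 3

/-- At `k = d` (`e = d − 1`, `d ≥ 3`, `p = q + 1` pairs): `h_{Ann ℓ_t}(d) = C(q+d, d) − (q+1)²` — the codimension of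
the locus of hypersurfaces containing a linear `ℙ^q` ([Movasati2017GMCD] Thm. 2).
[cite: Villaflorloyola2021, Proposition 4.1] [cite: DuqueFrancoVillaflor2025Join, Remark 7.1] -/
theorem hilbert_annIdeal_fermatLinearCycleFunctional_self {q d : ℕ} (t : Fin (q+1) → K) (hd : 3 ≤ d) :
    finrank K (homogeneousSubmodule (Fin (q+1) ⊕ Fin (q+1)) K d) -
        finrank K (idealDegree (annIdeal (fermatLinearCycleFunctional t (d - 1))) d) =
      (q + d).choose d - (q + 1) ^ 2 := by
  rw [hilbert_annIdeal_fermatLinearCycleFunctional t (by omega) d, ← linearCycleHF_eq_ciHilbert]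
  have h := linearCycleHF_self q d hd
  rw [Nat.choose_symm_add] at h
  omega

end OneCycle

/-! ## Two linear cycles `ℙ_{a,b}`, `ℙ_{a',b}` with the same pairing `b` -/

section TwoLinearCycles

variable [DecidableEq K] {n d : ℕ} (ζ : K) (a a' : Fin (n+2) → ℕ) (b : Equiv.Perm (Fin (n+2)))

/-- The COMMON pairs of `ℙ^{n/2}_{a,b}` and `ℙ^{n/2}_{a',b}`: the `e ≤ n/2` with the same equation
`x_{b(2e)} = ζ^{1+2a_{2e+1}} x_{b(2e+1)}`, i.e. `ζ^{1+2a_{2e+1}} = ζ^{1+2a'_{2e+1}}`; their number is `m + 1` where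
`ℙ_{a,b} ∩ ℙ_{a',b} = ℙ^m` (on a differing pair both coordinates vanish on the intersection).
[cite: MovasatiVillaflor2018, §1, Theorem 2] [cite: Villaflor2022PeriodsCI, Theorem 3] -/
def commonPairs (n : ℕ) (ζ : K) (a a' : Fin (n+2) → ℕ) : Finset (Fin (n/2+1)) :=
  agreePairs (twist n ζ a) (twist n ζ a')

omit [DecidableEq K] in
/-- The scalar `sign(b)·ζ^{Σ_e (1+2a_{2e+1})}` of the period functional is non-zero for `ζ ≠ 0`.
[cite: MovasatiVillaflor2018, Theorem 1] -/
theorem periodScalar_ne_zero (hζ : ζ ≠ 0) :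
    ((Equiv.Perm.sign b : ℤ) : K) * ζ ^ (∑ e : Fin (n/2+1), (1 + 2 * a ⟨2*e+1, by omega⟩)) ≠ 0 := by
  refine mul_ne_zero ?_ (pow_ne_zero _ hζ)
  rcases Int.units_eq_one_or (Equiv.Perm.sign b) with h | h <;> simp [h]

omit [DecidableEq K] in
/-- MV18 §5's `ρ = u·∫_ℙ + v·∫_ℙ̌` as a functional: `combFunctional [(u,a,b),(v,a',b)] = u ℓ_{a,b} + v ℓ_{a',b}`.
[cite: MovasatiVillaflor2018, §5] -/
theorem combFunctional_pair (hn : Even n) (u v : K) :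
    combFunctional n d ζ hn [(u, a, b), (v, a', b)] =
      u • linearCycleFunctional n d ζ a b hn + v • linearCycleFunctional n d ζ a' b hn := by
  simp [combFunctional]

omit [DecidableEq K] in
/-- **Transport to the pairs.** For `ζ ≠ 0`, `u ≠ 0`: `u ℓ_{a,b} + v ℓ_{a',b} = κ · (ℓ_{t} + w ℓ_{t'}) ∘ (relabeling)` with
`t = twist a`, `t' = twist a'` the twist vectors on the pairs, `κ ≠ 0`, and `w ≠ 0` iff `v ≠ 0` — the two period
functionals are the DFV functionals of the companion file read through `x_{b(2e)} ↦ x_{2e}`, `x_{b(2e+1)} ↦ x_{2e+1}`.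
[cite: MovasatiVillaflor2018, Theorem 1, §5] [cite: DuqueFrancoVillaflor2025Join, Remark 7.1] -/
theorem combFunctional_pair_eq_smul_comp (hn : Even n) (hζ : ζ ≠ 0) {u : K} (hu : u ≠ 0) (v : K) :
    ∃ κ w : K, κ ≠ 0 ∧ (v ≠ 0 → w ≠ 0) ∧
      combFunctional n d ζ hn [(u, a, b), (v, a', b)] =
        κ • ((fermatLinearCycleFunctional (twist n ζ a) (d - 1) +
            w • fermatLinearCycleFunctional (twist n ζ a') (d - 1)) ∘ₗ
          (rename ((pairEquiv n hn).trans b).symm :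
            MvPolynomial (Fin (n+2)) K →ₐ[K] MvPolynomial (Fin (n/2+1) ⊕ Fin (n/2+1)) K).toLinearMap) := by
  set κa := ((Equiv.Perm.sign b : ℤ) : K) * ζ ^ (∑ e : Fin (n/2+1), (1 + 2 * a ⟨2*e+1, by omega⟩)) with hκa
  set κa' := ((Equiv.Perm.sign b : ℤ) : K) * ζ ^ (∑ e : Fin (n/2+1), (1 + 2 * a' ⟨2*e+1, by omega⟩)) with hκa'
  have hκa0 : κa ≠ 0 := periodScalar_ne_zero ζ a b hζ
  have hκa'0 : κa' ≠ 0 := periodScalar_ne_zero ζ a' b hζ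
  refine ⟨u * κa, v * κa' / (u * κa), mul_ne_zero hu hκa0, fun hv =>
    div_ne_zero (mul_ne_zero hv hκa'0) (mul_ne_zero hu hκa0), ?_⟩
  rw [combFunctional_pair ζ a a' b hn u v]
  change u • (κa • (fermatLinearCycleFunctional (twist n ζ a) (d - 1) ∘ₗ _)) +
      v • (κa' • (fermatLinearCycleFunctional (twist n ζ a') (d - 1) ∘ₗ _)) = _
  rw [LinearMap.add_comp, LinearMap.smul_comp, smul_add, smul_smul, smul_smul, smul_smul,
    mul_div_cancel₀ _ (mul_ne_zero hu hκa0)]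

omit [DecidableEq K] in
/-- **`h_{Ann(u ℓ_{a,b} + v ℓ_{a',b})}(k) = h_{Ann(ℓ_t + w ℓ_{t'})}(k)`** for the `w ≠ 0` of the transport.
[cite: MovasatiVillaflor2018, §5, §6] [cite: Villaflorloyola2021, Proposition 4.1] -/
theorem exists_hilbert_annIdeal_combFunctional_pair_eq (hn : Even n) (hζ : ζ ≠ 0) {u v : K} (hu : u ≠ 0)
    (hv : v ≠ 0) :
    ∃ w : K, w ≠ 0 ∧ ∀ k,
      finrank K (homogeneousSubmodule (Fin (n+2)) K k) -
          finrank K (idealDegree (annIdeal (combFunctional n d ζ hn [(u, a, b), (v, a', b)])) k) =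
        finrank K (homogeneousSubmodule (Fin (n/2+1) ⊕ Fin (n/2+1)) K k) -
          finrank K (idealDegree (annIdeal (fermatLinearCycleFunctional (twist n ζ a) (d - 1) +
            w • fermatLinearCycleFunctional (twist n ζ a') (d - 1))) k) := by
  obtain ⟨κ, w, hκ, hw, heq⟩ := combFunctional_pair_eq_smul_comp ζ a a' b hn hζ hu v (d := d)
  refine ⟨w, hw hv, fun k => ?_⟩
  rw [heq, annIdeal_smul _ hκ, hilbert_annIdeal_comp_rename_symm]

omit [DecidableEq K] in
/-- **`h_{Ann ℓ_{a,b} ∩ Ann ℓ_{a',b}}(k) = h_{Ann ℓ_t ∩ Ann ℓ_{t'}}(k)`** (codimension of `T_0V_ℙ ∩ T_0V_ℙ̌` read on the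
pairs). [cite: Villaflor2022PeriodsCI, Proposition 7, Remark 7] [cite: Villaflorloyola2021, Proposition 4.1] -/
theorem hilbert_inf_annIdeal_linearCycleFunctional_eq (hn : Even n) (hζ : ζ ≠ 0) (k : ℕ) :
    finrank K (homogeneousSubmodule (Fin (n+2)) K k) -
        finrank K (idealDegree (annIdeal (linearCycleFunctional n d ζ a b hn) ⊓
          annIdeal (linearCycleFunctional n d ζ a' b hn)) k) =
      finrank K (homogeneousSubmodule (Fin (n/2+1) ⊕ Fin (n/2+1)) K k) -
        finrank K (idealDegree (annIdeal (fermatLinearCycleFunctional (twist n ζ a) (d - 1)) ⊓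
          annIdeal (fermatLinearCycleFunctional (twist n ζ a') (d - 1))) k) := by
  have h1 : annIdeal (linearCycleFunctional n d ζ a b hn) =
      annIdeal (fermatLinearCycleFunctional (twist n ζ a) (d - 1) ∘ₗ
        (rename ((pairEquiv n hn).trans b).symm :
          MvPolynomial (Fin (n+2)) K →ₐ[K] MvPolynomial (Fin (n/2+1) ⊕ Fin (n/2+1)) K).toLinearMap) := by
    rw [linearCycleFunctional, annIdeal_smul _ (periodScalar_ne_zero ζ a b hζ)]
  have h2 : annIdeal (linearCycleFunctional n d ζ a' b hn) =
      annIdeal (fermatLinearCycleFunctional (twist n ζ a') (d - 1) ∘ₗ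
        (rename ((pairEquiv n hn).trans b).symm :
          MvPolynomial (Fin (n+2)) K →ₐ[K] MvPolynomial (Fin (n/2+1) ⊕ Fin (n/2+1)) K).toLinearMap) := by
    rw [linearCycleFunctional, annIdeal_smul _ (periodScalar_ne_zero ζ a' b hζ)]
  rw [h1, h2, hilbert_inf_annIdeal_comp_rename_symm]

omit [DecidableEq K] in
/-- Degree bookkeeping: `d + ((n/2)d − n − 2) = (n/2+1)(d−2)` (`n` even, `n + 2 ≤ (n/2)d`): the row degree of
`[p_{i+j}]` is `σ − d`. [cite: Movasati2016Periods, Definition 1] -/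
theorem deg_add_rowDeg (hn : Even n) (hN : n + 2 ≤ n / 2 * d) :
    d + (n / 2 * d - n - 2) = (n / 2 + 1) * (d - 2) := by
  obtain ⟨k, hk⟩ : ∃ k, n = 2 * k := by obtain ⟨r, hr⟩ := hn; exact ⟨r, by omega⟩
  subst hk
  have hk2 : 2 * k / 2 = k := by omega
  rw [hk2] at hN ⊢
  obtain ⟨d', rfl⟩ : ∃ d', d = d' + 2 := ⟨d - 2, by
    by_contra h
    have : k * d ≤ k * 1 := Nat.mul_le_mul_left k (by omega)
    omega⟩
  have e1 : (k + 1) * (d' + 2 - 2) = k * d' + d' := by rw [Nat.add_sub_cancel]; ring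
  have e2 : k * (d' + 2) = k * d' + 2 * k := by ring
  rw [e2] at hN
  rw [e1, e2]
  omega

/-- **`codim (T_0V_ℙ ∩ T_0V_ℙ̌) = intdim`** at the level of Hilbert functions, for ALL `(n, d, m)`:
`dim S_d − dim (Ann ℓ_{a,b} ∩ Ann ℓ_{a',b})_d = 2·(C(n/2+d,d) − (n/2+1)²) − ciH_{m+1}(d)` where `m + 1` is the number
of common pairs (Villaflor §9: "`= 2·Codim T_0V_ℙ − Codim(T_0V_ℙ + T_0V_ℙ̌) = 2(C(n/2+d,d) − (n/2+1)²) − (C(m+d,d) − (m+1)²)`";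
Movasati Thm. 13). [cite: Villaflor2022PeriodsCI, Proposition 7 (proof), §9] [cite: Movasati2016Periods, Theorem 13] -/
theorem hilbert_inf_two_linearCycles (hn : Even n) (hN : n + 2 ≤ n / 2 * d) (hζ : ζ ≠ 0)
    (hne : twist n ζ a ≠ twist n ζ a') :
    finrank K (homogeneousSubmodule (Fin (n+2)) K d) -
        finrank K (idealDegree (annIdeal (linearCycleFunctional n d ζ a b hn) ⊓
          annIdeal (linearCycleFunctional n d ζ a' b hn)) d) =
      2 * ((n / 2 + d).choose d - (n / 2 + 1) ^ 2) -
        ciHilbert (List.replicate (commonPairs n ζ a a').card (d - 1)) d := by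
  have hd : 3 ≤ d := by
    by_contra h
    have : n / 2 * d ≤ n / 2 * 2 := Nat.mul_le_mul_left _ (by omega)
    omega
  rw [hilbert_inf_annIdeal_linearCycleFunctional_eq ζ a a' b hn hζ d]
  have hconc := fermatLinearCycleFunctional_homogeneousComponent (twist n ζ a) (d - 1)
  have hconc' := fermatLinearCycleFunctional_homogeneousComponent (twist n ζ a') (d - 1)
  have h1 := hilbert_inf_add_hilbert_sup (isHomogeneous_annIdeal hconc) (isHomogeneous_annIdeal hconc') d
  have h2 := hilbert_annIdeal_fermatLinearCycleFunctional_self (twist n ζ a) hd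
  have h3 := hilbert_annIdeal_fermatLinearCycleFunctional_self (twist n ζ a') hd
  have h4 := hilbert_sup_annIdeal_eq_ciHilbert (twist n ζ a) (twist n ζ a') (d - 1) (by omega) hne d
  rw [h2, h3, h4] at h1
  unfold commonPairs
  omega

/-- **MAIN THEOREM. The rank of `[p_{i+j}(u·ℙ^{n/2}_{a,b} + v·ℙ^{n/2}_{a',b})]` for every pair of distinct linear
cycles with a common pairing of the coordinates** (`n` even, `n + 2 ≤ (n/2)d`, `ζ ≠ 0`, `u, v ≠ 0`; `m + 1 = #` common
pairs): `rank = 2·(C(n/2+d,d) − (n/2+1)²) − ciH_{m+1}(d) − ciH_{m+1}((n/2)d − n − 2)` = `intdim^d_n(m)` MINUS the exact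
excess `#{β ∈ [0,d−2]^{m+1} : |β| = (n/2)d−n−2}` — MV18 Prop. 1 / Thm. 2 ("by a computer") and Villaflor's Thm. 3
(both halves) at the level of the period matrix, for all `(n,d,m)`; e.g. excess `1` for `(c−1)(d−2) = 2` and `n/2 − 1`
for `(c,d) = (2,3)` (Kloosterman Prop. 4.1). [cite: Villaflor2022PeriodsCI, Theorem 3, Remark 7]
[cite: MovasatiVillaflor2018, Proposition 1, Theorem 2] [cite: Movasati2016Periods, Theorem 13]
[cite: Kloosterman2025, Proposition 4.1, Example 4.2] -/
theorem rank_periodMatrix_two_linearCycles (hn : Even n) (hN : n + 2 ≤ n / 2 * d) (hζ : ζ ≠ 0)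
    (hne : twist n ζ a ≠ twist n ζ a') {u v : K} (hu : u ≠ 0) (hv : v ≠ 0) :
    (periodMatrix (n+2) d (n / 2 * d - n - 2) d (combPeriod n d ζ [(u, a, b), (v, a', b)])).rank =
      2 * ((n / 2 + d).choose d - (n / 2 + 1) ^ 2) -
        ciHilbert (List.replicate (commonPairs n ζ a a').card (d - 1)) d -
        ciHilbert (List.replicate (commonPairs n ζ a a').card (d - 1)) (n / 2 * d - n - 2) := by
  have hd : 3 ≤ d := by
    by_contra h
    have : n / 2 * d ≤ n / 2 * 2 := Nat.mul_le_mul_left _ (by omega)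
    omega
  have hdeg := deg_add_rowDeg hn hN
  obtain ⟨w, hw, hH⟩ := exists_hilbert_annIdeal_combFunctional_pair_eq ζ a a' b hn hζ hu hv (d := d)
  rw [rank_periodMatrix_comb ζ hn hN, hH d, ← hilbert_inf_two_linearCycles ζ a a' b hn hN hζ hne,
    hilbert_inf_annIdeal_linearCycleFunctional_eq ζ a a' b hn hζ d]
  -- on the pairs: the exact excess of the companion file
  have hσ : Fintype.card (Fin (n / 2 + 1)) * (d - 1 - 1) = (n / 2 + 1) * (d - 2) := by
    rw [Fintype.card_fin, show d - 1 - 1 = d - 2 by omega]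
  have hex := finrank_sub_finrank_eq_card_box (twist n ζ a) (twist n ζ a') (d - 1) (by omega) hne hw
    (a := d) (by rw [hσ]; omega)
  rw [hσ, show (n / 2 + 1) * (d - 2) - d = n / 2 * d - n - 2 by omega,
    card_box_eq_ciHilbert _ (by omega : 1 ≤ d - 1)] at hex
  have hle1 := Submodule.finrank_mono (idealDegree_mono (inf_annIdeal_le_annIdeal_add_smul
    (fermatLinearCycleFunctional (twist n ζ a) (d - 1)) (fermatLinearCycleFunctional (twist n ζ a') (d - 1)) w) d)
  have hle2 := finrank_idealDegree_le (annIdeal (fermatLinearCycleFunctional (twist n ζ a) (d - 1) +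
    w • fermatLinearCycleFunctional (twist n ζ a') (d - 1))) d
  unfold commonPairs
  omega

/-- **The same with Movasati's `intdim^d_n(m)` (Thm. 13, tree `Kloosterman2023.intdim n d (m+1)`):**
`rank [p_{i+j}(uℙ + vℙ̌)] = intdim^d_n(m) − #{β ∈ [0,d−2]^{m+1} : |β| = (n/2)d − n − 2}` (as integers).
[cite: Movasati2016Periods, Theorem 13, §6] [cite: Villaflor2022PeriodsCI, Theorem 3] -/
theorem rank_periodMatrix_two_linearCycles_int (hn : Even n) (hN : n + 2 ≤ n / 2 * d) (hζ : ζ ≠ 0)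
    (hne : twist n ζ a ≠ twist n ζ a') {u v : K} (hu : u ≠ 0) (hv : v ≠ 0) :
    ((periodMatrix (n+2) d (n / 2 * d - n - 2) d (combPeriod n d ζ [(u, a, b), (v, a', b)])).rank : ℤ) =
      intdim n d (commonPairs n ζ a a').card -
        ciHilbert (List.replicate (commonPairs n ζ a a').card (d - 1)) (n / 2 * d - n - 2) := by
  have hd : 3 ≤ d := by
    by_contra h
    have : n / 2 * d ≤ n / 2 * 2 := Nat.mul_le_mul_left _ (by omega)
    omega
  have hdeg := deg_add_rowDeg hn hN
  have hr := rank_periodMatrix_two_linearCycles ζ a a' b hn hN hζ hne hu hv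
  -- the ℕ identities behind the truncated subtractions (all genuine)
  obtain ⟨w, hw, -⟩ := exists_hilbert_annIdeal_combFunctional_pair_eq ζ a a' b hn hζ hu hv (d := d)
  have hconc := fermatLinearCycleFunctional_homogeneousComponent (twist n ζ a) (d - 1)
  have hconc' := fermatLinearCycleFunctional_homogeneousComponent (twist n ζ a') (d - 1)
  have h1 := hilbert_inf_add_hilbert_sup (isHomogeneous_annIdeal hconc) (isHomogeneous_annIdeal hconc') d
  have h2 := hilbert_annIdeal_fermatLinearCycleFunctional_self (twist n ζ a) hd
  have h3 := hilbert_annIdeal_fermatLinearCycleFunctional_self (twist n ζ a') hd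
  have h4 := hilbert_sup_annIdeal_eq_ciHilbert (twist n ζ a) (twist n ζ a') (d - 1) (by omega) hne d
  rw [h2, h3, h4] at h1
  have hσ : Fintype.card (Fin (n / 2 + 1)) * (d - 1 - 1) = (n / 2 + 1) * (d - 2) := by
    rw [Fintype.card_fin, show d - 1 - 1 = d - 2 by omega]
  have hex := finrank_sub_finrank_eq_card_box (twist n ζ a) (twist n ζ a') (d - 1) (by omega) hne hw
    (a := d) (by rw [hσ]; omega)
  rw [hσ, show (n / 2 + 1) * (d - 2) - d = n / 2 * d - n - 2 by omega,
    card_box_eq_ciHilbert _ (by omega : 1 ≤ d - 1)] at hex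
  have hle1 := Submodule.finrank_mono (idealDegree_mono (inf_annIdeal_le_annIdeal_add_smul
    (fermatLinearCycleFunctional (twist n ζ a) (d - 1)) (fermatLinearCycleFunctional (twist n ζ a') (d - 1)) w) d)
  have hle2 := finrank_idealDegree_le (annIdeal (fermatLinearCycleFunctional (twist n ζ a) (d - 1) +
    w • fermatLinearCycleFunctional (twist n ζ a') (d - 1))) d
  -- `intdim` in closed form
  have hlin : linC (n / 2 + 1) (n / 2 + 1) d + (n / 2 + 1) ^ 2 = (n / 2 + d).choose d := linC_closed_form _ _ _ hd
  have hlin' : linC (n + 2 - (agreePairs (twist n ζ a) (twist n ζ a')).card)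
      (agreePairs (twist n ζ a) (twist n ζ a')).card d =
      ciHilbert (List.replicate (agreePairs (twist n ζ a) (twist n ζ a')).card (d - 1)) d := by
    rw [linC_eq_linearCycleHF, linearCycleHF_eq_ciHilbert]
  unfold commonPairs at hr ⊢
  rw [intdim, hlin', hr]
  omega

/-- **Theorem 3 / Remark 7 at the level of the period matrix, all `(n, d, m)`:** `rank [p_{i+j}(uℙ + vℙ̌)]` equals
`codim (T_0V_ℙ ∩ T_0V_ℙ̌) = dim S_d − dim (Ann ℓ_ℙ ∩ Ann ℓ_ℙ̌)_d` **iff `2 < (n/2 − (m+1))·(d − 2)`**, i.e. iff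
`m < n/2 − d/(d−2)` (`(c−1)(d−2) > 2` in Kloosterman's notation, `c = n/2 − m`); otherwise it is strictly smaller
("the Zariski tangent space of `V_{[δ]}` has dimension strictly bigger"). [cite: Villaflor2022PeriodsCI, Theorem 3, Remark 7]
[cite: Kloosterman2025, Theorem 1.4, Proposition 4.1] [cite: MovasatiVillaflor2018, Theorem 2] -/
theorem rank_eq_hilbert_inf_iff (hn : Even n) (hN : n + 2 ≤ n / 2 * d) (hζ : ζ ≠ 0)
    (hne : twist n ζ a ≠ twist n ζ a') {u v : K} (hu : u ≠ 0) (hv : v ≠ 0) :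
    (periodMatrix (n+2) d (n / 2 * d - n - 2) d (combPeriod n d ζ [(u, a, b), (v, a', b)])).rank =
        finrank K (homogeneousSubmodule (Fin (n+2)) K d) -
          finrank K (idealDegree (annIdeal (linearCycleFunctional n d ζ a b hn) ⊓
            annIdeal (linearCycleFunctional n d ζ a' b hn)) d) ↔
      2 < (n / 2 - (commonPairs n ζ a a').card) * (d - 2) := by
  have hd : 3 ≤ d := by
    by_contra h
    have : n / 2 * d ≤ n / 2 * 2 := Nat.mul_le_mul_left _ (by omega)
    omega
  have hdeg := deg_add_rowDeg hn hN
  obtain ⟨w, hw, hH⟩ := exists_hilbert_annIdeal_combFunctional_pair_eq ζ a a' b hn hζ hu hv (d := d)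
  rw [rank_periodMatrix_comb ζ hn hN, hH d, hilbert_inf_annIdeal_linearCycleFunctional_eq ζ a a' b hn hζ d]
  have hσ : Fintype.card (Fin (n / 2 + 1)) * (d - 1 - 1) = (n / 2 + 1) * (d - 2) := by
    rw [Fintype.card_fin, show d - 1 - 1 = d - 2 by omega]
  have hex := finrank_sub_finrank_eq_card_box (twist n ζ a) (twist n ζ a') (d - 1) (by omega) hne hw
    (a := d) (by rw [hσ]; omega)
  have hle1 := Submodule.finrank_mono (idealDegree_mono (inf_annIdeal_le_annIdeal_add_smul
    (fermatLinearCycleFunctional (twist n ζ a) (d - 1)) (fermatLinearCycleFunctional (twist n ζ a') (d - 1)) w) d)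
  have hle2 := finrank_idealDegree_le (annIdeal (fermatLinearCycleFunctional (twist n ζ a) (d - 1) +
    w • fermatLinearCycleFunctional (twist n ζ a') (d - 1))) d
  have hpos := card_box_pos_iff (agreePairs (twist n ζ a) (twist n ζ a')) (e := d - 1) (by omega)
    (Fintype.card (Fin (n / 2 + 1)) * (d - 1 - 1) - d)
  have hED := card_agreePairs_add_card_diffPairs (twist n ζ a) (twist n ζ a')
  rw [Fintype.card_fin] at hED
  rw [hσ, show (n / 2 + 1) * (d - 2) - d = n / 2 * d - n - 2 by omega] at hex hpos
  unfold commonPairs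
  -- bookkeeping with the atoms `X = #E(d−2)`, `Y = #D(d−2)`
  obtain ⟨j0, hj0⟩ : ∃ j, twist n ζ a j ≠ twist n ζ a' j := by
    by_contra h
    push Not at h
    exact hne (funext h)
  have hDpos : 0 < (diffPairs (twist n ζ a) (twist n ζ a')).card :=
    Finset.card_pos.mpr ⟨j0, (mem_diffPairs _ _).mpr hj0⟩
  have hσ' : (n / 2 + 1) * (d - 2) = (agreePairs (twist n ζ a) (twist n ζ a')).card * (d - 2) +
      (diffPairs (twist n ζ a) (twist n ζ a')).card * (d - 2) := by
    rw [← add_mul, hED]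
  have hY : (n / 2 - (agreePairs (twist n ζ a) (twist n ζ a')).card) * (d - 2) =
      (diffPairs (twist n ζ a) (twist n ζ a')).card * (d - 2) - (d - 2) := by
    rw [show n / 2 - (agreePairs (twist n ζ a) (twist n ζ a')).card =
      (diffPairs (twist n ζ a) (twist n ζ a')).card - 1 by omega, Nat.sub_mul, one_mul]
  have hYge : d - 2 ≤ (diffPairs (twist n ζ a) (twist n ζ a')).card * (d - 2) :=
    Nat.le_mul_of_pos_left _ hDpos
  rw [show d - 1 - 1 = d - 2 by omega] at hpos
  -- `rank = intdim ⟺ box empty ⟺ (n/2)d − n − 2 > (m+1)(d−2) ⟺ 2 < (n/2 − m − 1)(d−2)`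
  have key : (box (agreePairs (twist n ζ a) (twist n ζ a')) (d - 1) (n / 2 * d - n - 2)).card = 0 ↔
      2 < (n / 2 - (agreePairs (twist n ζ a) (twist n ζ a')).card) * (d - 2) := by
    rw [hY]
    constructor
    · intro h0
      have hn0 : ¬ 0 < (box (agreePairs (twist n ζ a) (twist n ζ a')) (d - 1) (n / 2 * d - n - 2)).card := by omega
      rw [hpos] at hn0
      omega
    · intro h2
      have hn0 : ¬ n / 2 * d - n - 2 ≤ (agreePairs (twist n ζ a) (twist n ζ a')).card * (d - 2) := by omega
      rw [← hpos] at hn0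
      omega
  rw [← key]
  omega

/-- **MV18 Theorem 2's triples without the computer**: for every `(n,d,m)` in the printed list and every pair of
linear cycles `ℙ_{a,b}, ℙ_{a',b}` with `m + 1` common pairs, `rank [ρ_{i+j}] = dim S_d − dim (Ann ℓ_ℙ ∩ Ann ℓ_ℙ̌)_d`
(the number Prop. 1 verified by computer; "Proposition 1 implies that `V_{[Z_0]}` is smooth and reduced" is the cited,
transcendental step). [cite: MovasatiVillaflor2018, Proposition 1, Theorem 2] [cite: Villaflor2022PeriodsCI, Theorem 3] -/
theorem rank_eq_hilbert_inf_of_mem_mvTriples (hn : Even n) (hN : n + 2 ≤ n / 2 * d) (hζ : ζ ≠ 0)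
    (hne : twist n ζ a ≠ twist n ζ a') {u v : K} (hu : u ≠ 0) (hv : v ≠ 0)
    (hmem : (n, d, ((commonPairs n ζ a a').card : ℤ) - 1) ∈ mvTriples) :
    (periodMatrix (n+2) d (n / 2 * d - n - 2) d (combPeriod n d ζ [(u, a, b), (v, a', b)])).rank =
      finrank K (homogeneousSubmodule (Fin (n+2)) K d) -
        finrank K (idealDegree (annIdeal (linearCycleFunctional n d ζ a b hn) ⊓
          annIdeal (linearCycleFunctional n d ζ a' b hn)) d) := by
  rw [rank_eq_hilbert_inf_iff ζ a a' b hn hN hζ hne hu hv]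
  have h := mvTriples_threshold _ hmem
  obtain ⟨-, -, hle, hlt⟩ := h
  -- `(d−2)(n − 2m) > 2d` with `m + 1 = #common ≤ n/2` gives `2 < (n/2 − (m+1))(d−2)`
  have hED := card_agreePairs_add_card_diffPairs (twist n ζ a) (twist n ζ a')
  rw [Fintype.card_fin] at hED
  have hk : n = 2 * (n / 2) := by obtain ⟨r, hr⟩ := hn; omega
  have hd : 3 ≤ d := by
    by_contra h'
    have : n / 2 * d ≤ n / 2 * 2 := Nat.mul_le_mul_left _ (by omega)
    omega
  simp only at hle hlt
  rw [commonPairs] at hle hlt ⊢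
  set m1 := (agreePairs (twist n ζ a) (twist n ζ a')).card with hm1
  have hm1le : m1 ≤ n / 2 + 1 := by omega
  -- pass to integers
  have key : (2 : ℤ) < ((n / 2 : ℕ) - (m1 : ℤ)) * ((d : ℤ) - 2) := by
    have e1 : ((d : ℤ) - 2) * ((n : ℤ) - 2 * ((m1 : ℤ) - 1)) =
        2 * (((n / 2 : ℕ) - (m1 : ℤ)) * ((d : ℤ) - 2)) + 2 * d - 4 := by
      have : (n : ℤ) = 2 * (n / 2 : ℕ) := by exact_mod_cast hk
      rw [this]
      ring
    rw [e1] at hlt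
    linarith
  have hd2 : 2 ≤ d := by omega
  have hm1le' : m1 ≤ n / 2 := by
    by_contra h'
    have h1 : ((n / 2 : ℕ) - (m1 : ℤ)) ≤ 0 := by push_cast; omega
    have hd' : (0 : ℤ) ≤ (d : ℤ) - 2 := by omega
    have hprod : ((n / 2 : ℕ) - (m1 : ℤ)) * ((d : ℤ) - 2) ≤ 0 := mul_nonpos_iff.mpr (Or.inr ⟨h1, hd'⟩)
    linarith
  zify [hm1le', hd2]
  exact key

/-! ### Named closed forms of the excess in Kloosterman's three small cases

With `c := n/2 + 1 − #(common pairs)` the codimension of `ℙ ∩ ℙ̌` in the two planes (Kloosterman's `c`; Movasati's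
`n/2 − m`), the excess `intdim − rank = ciH_{#common}((n/2)d − n − 2)` of `rank_periodMatrix_two_linearCycles_int`
is `n/2 − 1` for `(c, d) = (2, 3)` and `1` for `(c, d) ∈ {(3, 3), (2, 4)}` — the values "`k + 1 − c`" and "one" of
`h_{I₁+I₂}(kd − k − 2)` that Kloosterman's Prop. 4.1 prints as UPPER BOUNDS for the excess, ATTAINED here for every
`u, v ≠ 0` and every even `n` (cell pub-hlocus: the first-order excess `e(X_F; λ)` of every cubic standard pair
`(n, 3, n/2 − 2)`, of `(n, 3, n/2 − 3)`, and of the quartic pairs `(n, 4, n/2 − 2)`, e.g. `(8,4,2)`: `84 − 83`). -/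

/-- Two linear cycles with fewer than `n/2 + 1` common pairs have different twist vectors.
[cite: MovasatiVillaflor2018, §1] -/
theorem twist_ne_of_card_commonPairs_lt (h : (commonPairs n ζ a a').card < n / 2 + 1) :
    twist n ζ a ≠ twist n ζ a' := by
  intro he
  have : (commonPairs n ζ a a').card = n / 2 + 1 := by
    unfold commonPairs agreePairs
    rw [Finset.filter_true_of_mem fun e _ => congr_fun he e, Finset.card_univ, Fintype.card_fin]
  omega

/-- **Cubic, planes meeting in codimension 2** (`d = 3`, `#common pairs = n/2 − 1`, i.e. `ℙ ∩ ℙ̌ = ℙ^{n/2−2}`, the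
census's standard cubic pair `(n, 3, n/2 − 2)`): `rank [p_{i+j}(uℙ + vℙ̌)] = intdim³ₙ(n/2 − 2) − (n/2 − 1)` for ALL
`u, v ≠ 0` and all even `n ≥ 4` — excess `n/2 − 1` (Kloosterman's bound `k + 1 − c`, attained; Movasati's Table 1
column `c = 2`: `1, 2, 3, 4, 5` for `n = 4, …, 12`). [cite: Kloosterman2025, Proposition 4.1]
[cite: Villaflor2022PeriodsCI, Theorem 3 (proof)] [cite: Movasati2016Periods, §6 Table 1 (12mar2017)] -/
theorem rank_two_linearCycles_cubic_codimTwo (hn : Even n) (hN : n + 2 ≤ n / 2 * 3) (hζ : ζ ≠ 0)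
    (hc : (commonPairs n ζ a a').card = n / 2 - 1) {u v : K} (hu : u ≠ 0) (hv : v ≠ 0) :
    ((periodMatrix (n+2) 3 (n / 2 * 3 - n - 2) 3 (combPeriod n 3 ζ [(u, a, b), (v, a', b)])).rank : ℤ) =
      intdim n 3 (n / 2 - 1) - ((n / 2 - 1 : ℕ) : ℤ) := by
  have hne := twist_ne_of_card_commonPairs_lt ζ a a' (by omega)
  have hk : n = 2 * (n / 2) := by obtain ⟨r, hr⟩ := hn; omega
  rw [rank_periodMatrix_two_linearCycles_int ζ a a' b hn hN hζ hne hu hv, hc,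
    show n / 2 * 3 - n - 2 = n / 2 - 2 by omega, show (3 : ℕ) - 1 = 2 from rfl,
    Movasati2016.ciHilbert_replicate_two]
  obtain ⟨k, hk1, hk2⟩ : ∃ k, n / 2 - 1 = k + 1 ∧ n / 2 - 2 = k := ⟨n / 2 - 2, by omega, rfl⟩
  rw [hk1, hk2, Nat.choose_succ_self_right]

/-- **The same, excess form**: `intdim³ₙ(n/2 − 2) − rank = n/2 − 1` for the cubic pairs meeting in codimension 2.
[cite: Kloosterman2025, Proposition 4.1] [cite: Villaflor2022PeriodsCI, Theorem 3 (proof)] -/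
theorem excess_two_linearCycles_cubic_codimTwo (hn : Even n) (hN : n + 2 ≤ n / 2 * 3) (hζ : ζ ≠ 0)
    (hc : (commonPairs n ζ a a').card = n / 2 - 1) {u v : K} (hu : u ≠ 0) (hv : v ≠ 0) :
    intdim n 3 (n / 2 - 1) -
        ((periodMatrix (n+2) 3 (n / 2 * 3 - n - 2) 3 (combPeriod n 3 ζ [(u, a, b), (v, a', b)])).rank : ℤ) =
      ((n / 2 - 1 : ℕ) : ℤ) := by
  rw [rank_two_linearCycles_cubic_codimTwo ζ a a' b hn hN hζ hc hu hv]
  ring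

/-- **Cubic, planes meeting in codimension 3** (`d = 3`, `#common pairs = n/2 − 2`, `ℙ ∩ ℙ̌ = ℙ^{n/2−3}`):
`rank = intdim³ₙ(n/2 − 3) − 1` for all `u, v ≠ 0` — excess `1` (`(c − 1)(d − 2) = 2`; Table 1 column `c = 3`).
[cite: Kloosterman2025, Proposition 4.1] [cite: Villaflor2022PeriodsCI, Theorem 3 (proof)]
[cite: Movasati2016Periods, §6 Table 1 (12mar2017)] -/
theorem rank_two_linearCycles_cubic_codimThree (hn : Even n) (hN : n + 2 ≤ n / 2 * 3) (hζ : ζ ≠ 0)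
    (hc : (commonPairs n ζ a a').card = n / 2 - 2) {u v : K} (hu : u ≠ 0) (hv : v ≠ 0) :
    ((periodMatrix (n+2) 3 (n / 2 * 3 - n - 2) 3 (combPeriod n 3 ζ [(u, a, b), (v, a', b)])).rank : ℤ) =
      intdim n 3 (n / 2 - 2) - 1 := by
  have hne := twist_ne_of_card_commonPairs_lt ζ a a' (by omega)
  have hk : n = 2 * (n / 2) := by obtain ⟨r, hr⟩ := hn; omega
  rw [rank_periodMatrix_two_linearCycles_int ζ a a' b hn hN hζ hne hu hv, hc,
    show n / 2 * 3 - n - 2 = n / 2 - 2 by omega, show (3 : ℕ) - 1 = 2 from rfl,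
    Movasati2016.ciHilbert_replicate_two, Nat.choose_self, Nat.cast_one]

/-- **Quartic, planes meeting in codimension 2** (`d = 4`, `#common pairs = n/2 − 1`, `ℙ ∩ ℙ̌ = ℙ^{n/2−2}`; the
census rows `(6,4,1)`: `37 − 36`, `(8,4,2)`: `84 − 83`): `rank = intdim⁴ₙ(n/2 − 2) − 1` for all `u, v ≠ 0` and all
even `n ≥ 4` — excess `1` (`(c − 1)(d − 2) = 2`). [cite: Kloosterman2025, Proposition 4.1]
[cite: Villaflor2022PeriodsCI, Theorem 3 (proof)] [cite: Movasati2016Periods, §6] -/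
theorem rank_two_linearCycles_quartic_codimTwo (hn : Even n) (hN : n + 2 ≤ n / 2 * 4) (hζ : ζ ≠ 0)
    (hc : (commonPairs n ζ a a').card = n / 2 - 1) {u v : K} (hu : u ≠ 0) (hv : v ≠ 0) :
    ((periodMatrix (n+2) 4 (n / 2 * 4 - n - 2) 4 (combPeriod n 4 ζ [(u, a, b), (v, a', b)])).rank : ℤ) =
      intdim n 4 (n / 2 - 1) - 1 := by
  have hne := twist_ne_of_card_commonPairs_lt ζ a a' (by omega)
  have hk : n = 2 * (n / 2) := by obtain ⟨r, hr⟩ := hn; omega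
  have htop : ciHilbert (List.replicate (n / 2 - 1) 3) (n / 2 * 4 - n - 2) = 1 := by
    have h := HodgeTheory.ciHilbert_ofFn_socle (fun _ : Fin (n / 2 - 1) => 3) (fun _ => by norm_num)
    rw [List.ofFn_const, Finset.sum_const, Finset.card_univ, Fintype.card_fin, smul_eq_mul] at h
    rw [show n / 2 * 4 - n - 2 = (n / 2 - 1) * (3 - 1) by omega]
    exact h
  rw [rank_periodMatrix_two_linearCycles_int ζ a a' b hn hN hζ hne hu hv, hc, show (4 : ℕ) - 1 = 3 from rfl, htop,
    Nat.cast_one]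


/-- Two DISTINCT twist vectors leave at most `n/2` common pairs. [cite: MovasatiVillaflor2018, §1] -/
theorem card_commonPairs_le_of_twist_ne (hne : twist n ζ a ≠ twist n ζ a') :
    (commonPairs n ζ a a').card ≤ n / 2 := by
  by_contra h
  have hle : (commonPairs n ζ a a').card ≤ n / 2 + 1 := by
    unfold commonPairs agreePairs
    exact (Finset.card_filter_le _ _).trans (by rw [Finset.card_univ, Fintype.card_fin])
  have hall : commonPairs n ζ a a' = Finset.univ :=
    Finset.eq_univ_of_card _ (by rw [Fintype.card_fin]; omega)
  apply hne
  funext e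
  have he : e ∈ commonPairs n ζ a a' := hall ▸ Finset.mem_univ e
  unfold commonPairs agreePairs at he
  exact (Finset.mem_filter.mp he).2

/-- **Movasati's cubic excess law (§6 Table 1) for EVERY even `n`:** for any two distinct linear cycles of the cubic
Fermat `n`-fold with a common pairing, `c := n/2 + 1 − #(common pairs)` the codimension of `ℙ ∩ ℙ̌` in the planes,
and any `u, v ≠ 0`: `intdim³ₙ − rank [p_{i+j}(uℙ + vℙ̌)] = excessLaw n c` (`= C(n/2, 2)`, `n/2 − 1`, `1`, `0` for
`c = 1, 2, 3, ≥ 4`) — the column law `Movasati2016.excess_column` (there checked on the 25 printed cells, `n ≤ 12`)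
as a theorem for all `n`, both signs and all ratios `u : v`. [cite: Movasati2016Periods, §6 Table 1 (12mar2017), Theorem 13]
[cite: Villaflor2022PeriodsCI, Theorem 3 (proof)] [cite: Kloosterman2025, Proposition 4.1] -/
theorem excess_two_linearCycles_cubic_eq_excessLaw (hn : Even n) (hN : n + 2 ≤ n / 2 * 3) (hζ : ζ ≠ 0)
    (hne : twist n ζ a ≠ twist n ζ a') {u v : K} (hu : u ≠ 0) (hv : v ≠ 0) :
    intdim n 3 (commonPairs n ζ a a').card -
        ((periodMatrix (n+2) 3 (n / 2 * 3 - n - 2) 3 (combPeriod n 3 ζ [(u, a, b), (v, a', b)])).rank : ℤ) =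
      Movasati2016.excessLaw n (n / 2 + 1 - (commonPairs n ζ a a').card) := by
  have hk : n = 2 * (n / 2) := by obtain ⟨r, hr⟩ := hn; omega
  have hle := card_commonPairs_le_of_twist_ne ζ a a' hne
  rw [rank_periodMatrix_two_linearCycles_int ζ a a' b hn hN hζ hne hu hv,
    show n / 2 * 3 - n - 2 = n / 2 - 2 by omega, show (3 : ℕ) - 1 = 2 from rfl,
    Movasati2016.ciHilbert_replicate_two, sub_sub_cancel]
  norm_cast
  unfold Movasati2016.excessLaw
  set c' := (commonPairs n ζ a a').card with hc'
  obtain h1 | h2 | h3 | h4 :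
      c' = n / 2 ∨ c' = n / 2 - 1 ∨ (c' = n / 2 - 2 ∧ 2 ≤ n / 2) ∨ c' + 3 ≤ n / 2 := by omega
  · rw [if_pos (by omega), h1]
    exact Nat.choose_symm (by omega)
  · rw [if_neg (by omega), if_pos (by omega), h2]
    obtain ⟨k, hk1, hk2⟩ : ∃ k, n / 2 - 1 = k + 1 ∧ n / 2 - 2 = k := ⟨n / 2 - 2, by omega, rfl⟩
    rw [hk1, hk2, Nat.choose_succ_self_right]
  · rw [if_neg (by omega), if_neg (by omega), if_pos (by omega), h3.1, Nat.choose_self]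
  · rw [if_neg (by omega), if_neg (by omega), if_neg (by omega)]
    exact Nat.choose_eq_zero_of_lt (by omega)

/-- `#{β ∈ {0,1,2}^h : |β| = 0} = 1`. [cite: Kloosterman2023, §2 eq. (1)] -/
private theorem ciHilbert_replicate_three_zero (h : ℕ) : ciHilbert (List.replicate h 3) 0 = 1 := by
  induction h with
  | zero => rfl
  | succ h ih => rw [List.replicate_succ, Kloosterman2023.ciHilbert_cons]; simp [List.range_succ, ih]

/-- `#{β ∈ {0,1,2}^h : |β| = 1} = h`. [cite: Kloosterman2023, §2 eq. (1)] -/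
private theorem ciHilbert_replicate_three_one (h : ℕ) : ciHilbert (List.replicate h 3) 1 = h := by
  induction h with
  | zero => rfl
  | succ h ih =>
    rw [List.replicate_succ, Kloosterman2023.ciHilbert_cons]
    simp [List.range_succ, ih, ciHilbert_replicate_three_zero]

/-- `#{β ∈ {0,1,2}^h : |β| = 2} = C(h+1, 2)` (Pascal). [cite: Kloosterman2023, §2 eq. (1)] -/
private theorem ciHilbert_replicate_three_two (h : ℕ) :
    ciHilbert (List.replicate h 3) 2 = (h + 1).choose 2 := by
  induction h with
  | zero => rfl
  | succ h ih =>
    have key : (h + 1 + 1).choose 2 = (h + 1).choose 2 + (h + 1) := by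
      rw [Nat.choose_succ_succ' (h + 1) 1, Nat.choose_one_right]; ring
    rw [List.replicate_succ, Kloosterman2023.ciHilbert_cons, key]
    simp [List.range_succ, ih, ciHilbert_replicate_three_one, ciHilbert_replicate_three_zero]

/-- **Quartic, planes meeting in codimension 1** (`d = 4`, `#common pairs = n/2`, `ℙ ∩ ℙ̌ = ℙ^{n/2−1}`; the census's
R7 rows `(4,4,1)`: two planes of the Fermat quartic fourfold meeting in a line, rank `8 = 11 − 3`, both signs):
`rank [p_{i+j}(uℙ + vℙ̌)] = intdim⁴ₙ(n/2 − 1) − C(n/2 + 1, 2)` for all `u, v ≠ 0` and all even `n ≥ 4` — excess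
`C(n/2 + 1, 2) = #{β ∈ [0,2]^{n/2} : |β| = 2}` (the box count at degree `n − 2`, by the Gorenstein symmetry of the
box). [cite: Villaflor2022PeriodsCI, Theorem 3 (proof)] [cite: Kloosterman2025, Lemma 3.12, Proposition 4.1]
[cite: Movasati2016Periods, Theorem 13, §6] -/
theorem rank_two_linearCycles_quartic_codimOne (hn : Even n) (hN : n + 2 ≤ n / 2 * 4) (hζ : ζ ≠ 0)
    (hc : (commonPairs n ζ a a').card = n / 2) {u v : K} (hu : u ≠ 0) (hv : v ≠ 0) :
    ((periodMatrix (n+2) 4 (n / 2 * 4 - n - 2) 4 (combPeriod n 4 ζ [(u, a, b), (v, a', b)])).rank : ℤ) =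
      intdim n 4 (n / 2) - ((n / 2 + 1).choose 2 : ℕ) := by
  have hne := twist_ne_of_card_commonPairs_lt ζ a a' (by omega)
  have hk : n = 2 * (n / 2) := by obtain ⟨r, hr⟩ := hn; omega
  have hsymm : ciHilbert (List.replicate (n / 2) 3) (n / 2 * 4 - n - 2) = ciHilbert (List.replicate (n / 2) 3) 2 := by
    have h := HodgeTheory.ciHilbert_ofFn_symm (fun _ : Fin (n / 2) => 3) (fun _ => by norm_num)
      (t := n / 2 * 4 - n - 2) (u := 2)
      (by rw [Finset.sum_const, Finset.card_univ, Fintype.card_fin, smul_eq_mul]; omega)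
    rwa [List.ofFn_const] at h
  rw [rank_periodMatrix_two_linearCycles_int ζ a a' b hn hN hζ hne hu hv, hc, show (4 : ℕ) - 1 = 3 from rfl, hsymm,
    ciHilbert_replicate_three_two]


end TwoLinearCycles

/-! ## Movasati's printed numbers are the theorem's values -/

section Tables

/-- **Movasati's cubic Table 1, rank column** (`n = 4,…,12`, `c = n/2 − m ≥ 1`, 25 cells): every printed
`mydim³ₙ(m) = rank [p_{i+j}]([ℙ]+[ℙ̌])` equals `2·C_{1^{n/2+1},2^{n/2+1}} − ciH_{m+1}(3) − ciH_{m+1}(n/2 − 2)`, the value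
of `rank_periodMatrix_two_linearCycles` at `d = 3` (row degree `(n/2)·3 − n − 2 = n/2 − 2`) — so each of the 25 cells
is an instance of that theorem (and of Villaflor's Thm. 3 for the 10 cells with `rank = intdim`).
[cite: Movasati2016Periods, §6 Table 1 (12mar2017), Theorem 13] [cite: Villaflor2022PeriodsCI, Theorem 3] -/
theorem movasatiTable_rank_eq :
    ∀ x ∈ Movasati2016.cells, 1 ≤ x.2 →
      Movasati2016.rankAt x.1 x.2 =
        some (2 * linC (x.1 / 2 + 1) (x.1 / 2 + 1) 3 - ciHilbert (List.replicate (x.1 / 2 + 1 - x.2) 2) 3 -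
          ciHilbert (List.replicate (x.1 / 2 + 1 - x.2) 2) (x.1 / 2 - 2)) := by
  decide

/-- **The excess column of Table 1 is the box count** `ciH_{m+1}(n/2 − 2)`: `C(n/2, 2)` for `c = 1`, `n/2 − 1` for
`c = 2`, `1` for `c = 3`, `0` for `c ≥ 4` (the companion file's `excess_column`, now explained).
[cite: Movasati2016Periods, §6 Table 1 (12mar2017)] [cite: Kloosterman2025, Proposition 4.1] -/
theorem movasatiTable_excess_eq_ciHilbert :
    ∀ x ∈ Movasati2016.cells, 1 ≤ x.2 →
      ((Movasati2016.entry x.1 x.2).map fun e => e.2 - e.1) =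
        some (ciHilbert (List.replicate (x.1 / 2 + 1 - x.2) 2) (x.1 / 2 - 2)) := by
  decide

/-- **Movasati's nine five-tuples `(n,d,m | rank, intdim)` of §6** (`(4,4,0|11,12)`, `(4,4,−1|12,12)`, `(4,5,0|24,24)`,
`(4,5,−1|24,24)`, `(4,6,0|38,38)`, `(4,6,−1|38,38)`, `(6,4,1|36,37)`, `(6,4,0|38,38)`, `(6,4,−1|38,38)`): each printed
rank is `intdim − ciH_{m+1}((n/2)d − n − 2)`. [cite: Movasati2016Periods, §6] [cite: Villaflor2022PeriodsCI, Theorem 3] -/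
theorem movasati_fiveTuples_rank_eq :
    (intdim 4 4 1 - ciHilbert (List.replicate 1 3) 2 = 11 ∧ intdim 4 4 0 - ciHilbert (List.replicate 0 3) 2 = 12) ∧
    (intdim 4 5 1 - ciHilbert (List.replicate 1 4) 4 = 24 ∧ intdim 4 5 0 - ciHilbert (List.replicate 0 4) 4 = 24) ∧
    (intdim 4 6 1 - ciHilbert (List.replicate 1 5) 6 = 38 ∧ intdim 4 6 0 - ciHilbert (List.replicate 0 5) 6 = 38) ∧
    (intdim 6 4 2 - ciHilbert (List.replicate 2 3) 4 = 36 ∧ intdim 6 4 1 - ciHilbert (List.replicate 1 3) 4 = 38 ∧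
      intdim 6 4 0 - ciHilbert (List.replicate 0 3) 4 = 38) := by
  decide

end Tables

end Literature.AlgebraicGeometry.Villaflor2022

end
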